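import Summits.Ventures.CertifiedManyBodySolver.Downfold.EmeryThermalBandSeam
import Summits.Ventures.CertifiedManyBodySolver.Downfold.EmeryBoxesBi2223OPMoreePPFloorWord
import HarnessLib

/-!
# `T > 0` CAP WORDS (hypothesis-free) on Bi2Sr2Ca2Cu3O10 (M307 Bi-2223) OP plane Cu-OP — U-SLICE «Morée 2022 PP cGW-SIC Bi2212 δ 0. — `emeryBoxBi2223OPMoreePP` (router/EMERY-FLOOR-ORDERS row 84; COVERAGE BATCH 3)

Venture CertifiedManyBodySolver, cell `pub/hubbard-downfold` (S1 = ROUTER) × crew hubbard-fast S2 (ii) × (iv) «T > 0 × multi-band»; seat hubbard-downfold-mod-4 (S1/S2 Emery seam).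
Namespace `Summit.Ventures.CertifiedManyBodySolver.Downfold`. PATTERN OF `EmeryThermalCapFromFloorSeam` / `EmeryThermalBandSeam`: the floor word `EmeryBoxesBi2223OPMoreePPFloorWord` proves the four
tilted CuO₄ certificates `bi2223OPMoreePPFloor_hq_lowerCorner` (device hubbard-box-p2 kgp1x5 chain, run for batch 3 by this seat, kit j316623); through hubbard-box-p1's R153 they are four
exact-tilt corner CAPS on the cell pressure (§1; tilts μ = (-107/10, -56/5, -11, -23/2), q₀ = (-876461719/10000000, -937989063/10000000, -455255469/5000000, -97207/1000), slopes −q₀/2 = (43.8231, 46.8995, 45.5255, 48.6035) eV/CuO₂);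
by monotone level transfer and convexity they bind the box at εp = -107/10: **`emeryBoxBi2223OPMoreePP_pressureCap_m107o10`** `P_cell ≤ 6 log 2 + 48.6035000·β` (§2) and interpolate on the
`t_pd × t_pp` face (§3, face-centre slope 46.2129). No Rayleigh family exists for this object yet, so no floor / window at T > 0 is stated (the T = 0 floor word is).

Everything PROVED (0 sorry); no definition. HONEST FRAMING: certified inequalities on a SCREENING/EXTRAPOLATED object (U-slice / companion per EMERY-LINE); full entropy
`6 log 2` kept; grand-canonical at the stated level; no phase word; no router number moves.
-/

noncomputable section

namespace Summit.Ventures.CertifiedManyBodySolver.Downfold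

open NonemptyInterval Matrix Finset Literature.Probability.LatticeModels
open Literature.MathematicalPhysics.QuantumLattice Literature.Computation.Certificates
open Summit.Ventures.CertifiedManyBodySolver.Certificates OccupationCode ClusterLowerBound
open scoped BigOperators ComplexOrder

/-! ## §1 Tilts, slopes, exact-tilt corner caps -/

/-- Every tilt is at most the common level `-107/10` (tilts `(-107/10, -56/5, -11, -23/2)`). [folklore] -/
theorem bi2223OPMoreePPFloor_mu_le_m107o10 (i : Fin 4) : bi2223OPMoreePPFloor_mu i ≤ ((-107/10 : ℚ) : ℝ) := by
  fin_cases i <;> simp [bi2223OPMoreePPFloor_mu] <;> norm_num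

/-- Every corner cap slope `−q₀ᵢ/2` is at most `97207/2000` = 48.6035000 (corner 3); slopes `(43.8231, 46.8995, 45.5255, 48.6035)` eV per CuO₂ per unit β. [folklore] -/
theorem bi2223OPMoreePPFloor_capSlope_le (i : Fin 4) : -bi2223OPMoreePPFloor_q0 i / 2 ≤ (97207/2000 : ℝ) := by
  fin_cases i <;> simp [bi2223OPMoreePPFloor_q0] <;> norm_num

/-- **EXACT-TILT CORNER CAPS** (hypothesis-free, every β ≥ 0): `P_cell(β, emeryLine cuprateSigns (bi2223OPMoreePPCorner i) + μᵢ·levelDir) ≤ 6 log 2 + β·(−q₀ᵢ/2)` — the floor word's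
certificate `bi2223OPMoreePPFloor_hq_lowerCorner i` through hubbard-box-p1's `emeryCellPressure_le_of_cuO4Certificate`. [cite: Israel1979, Thm. I.2.4] [cite: ValentiStolzeHirschfeld1991, §II] -/
theorem emeryBoxBi2223OPMoreePP_corner_pressureCap {β : ℝ} (hβ : 0 ≤ β) (i : Fin 4) :
    emeryCellPressure β (emeryLine cuprateSigns (bi2223OPMoreePPCorner i) + bi2223OPMoreePPFloor_mu i • levelDir) ≤ 6 * Real.log 2 + β * (-bi2223OPMoreePPFloor_q0 i / 2) := by
  have h := emeryCellPressure_tiltedCorner_le_of_cuO4Certificate hβ (emeryLine cuprateSigns (bi2223OPMoreePPCorner i)) (bi2223OPMoreePPFloor_mu i) (M := 2) two_pos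
    (G := (fun _ : Fin 4 => (0 : FermionOp emeryCuO4Window)) i) (fun ω' _ => re_expect_zero_cuO4 ω') (q₀ := bi2223OPMoreePPFloor_q0 i)
    (by rw [← bi2223OPMoreePP_lowerCorner]; simpa using bi2223OPMoreePPFloor_hq_lowerCorner i)
  simpa using h

/-! ## §2 The box cap word at the common level `εp = -107/10` (= max μᵢ; chemical potential 107/10 eV) -/

/-- **THE THERMAL CAP WORD (hypothesis-free)** on `emeryBoxBi2223OPMoreePP`, cuprate signs, level `εp = -107/10`, EVERY β ≥ 0, EVERY point of the box:
`P_cell ≤ 6 log 2 + β·97207/2000` (48.6035·β + 4.1589). [cite: Israel1979, Thm. I.2.4] [cite: ValentiStolzeHirschfeld1991, §II] -/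
theorem emeryBoxBi2223OPMoreePP_pressureCap_m107o10 {β : ℝ} (hβ : 0 ≤ β) :
    HoldsOn (fun p : EmeryCoord → ℝ => emeryCellPressure β (emeryLine cuprateSigns (emeryLineCoords (((-107/10 : ℚ)) : ℝ) p)) ≤ 6 * Real.log 2 + β * (97207/2000)) emeryBoxBi2223OPMoreePP :=
  holdsOn_emeryCellPressureCap_of_tiltedCuO4Certificates (E := emeryBoxBi2223OPMoreePP) (eA := bi2223OPMoreePPEmery_tpd) (eB := bi2223OPMoreePPEmery_tpp) (eD := bi2223OPMoreePPEmery_Delta) (eUd := bi2223OPMoreePPEmery_Udd) (eUp := bi2223OPMoreePPEmery_Upp) (by simp [emeryBoxBi2223OPMoreePP, emeryBoxBi2223OPMoreePPSrc, Function.update]) (by simp [emeryBoxBi2223OPMoreePP, emeryBoxBi2223OPMoreePPSrc, Function.update]) (Function.update_self _ _ _) (by simp [emeryBoxBi2223OPMoreePP, emeryBoxBi2223OPMoreePPSrc, Function.update]) (by simp [emeryBoxBi2223OPMoreePP, emeryBoxBi2223OPMoreePPSrc, Function.update]) cuprateSigns hβ (M := 2) two_pos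
    (fun _ => 0) (fun _ ω' _ => re_expect_zero_cuO4 ω') bi2223OPMoreePPFloor_mu bi2223OPMoreePPFloor_q0 bi2223OPMoreePPFloor_hq_lowerCorner bi2223OPMoreePPFloor_mu_le_m107o10
    (fun i => by have h := bi2223OPMoreePPFloor_capSlope_le i; simpa [div_eq_mul_inv] using h)

/-- **Grand-potential reading**: at chemical potential 107/10 eV, every `T > 0`, every point: `Ω/CuO₂ = −P_cell/β ≥ −97207/2000 − 6 log 2/β` eV. [cite: Israel1979, Thm. I.2.4] -/
theorem emeryBoxBi2223OPMoreePP_grandPotential_ge_m107o10 {β : ℝ} (hβ : 0 < β) :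
    HoldsOn (fun p : EmeryCoord → ℝ => -(97207/2000 : ℝ) - 6 * Real.log 2 / β ≤ -emeryCellPressure β (emeryLine cuprateSigns (emeryLineCoords (((-107/10 : ℚ)) : ℝ) p)) / β) emeryBoxBi2223OPMoreePP :=
  holdsOn_grandPotential_ge_of_pressureCap cuprateSigns hβ _ (emeryBoxBi2223OPMoreePP_pressureCap_m107o10 hβ.le)

/-! ## §3 The bilinear (function-valued) cap on the `t_pd × t_pp` face -/

/-- **BILINEAR THERMAL CAP (hypothesis-free)**, level `εp = -107/10`, EVERY β ≥ 0, EVERY point (face `t_pd ∈ [59/50, 139/100]`, `t_pp ∈ [61/100, 18/25]`; face-centre slope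
46.2129 vs the constant word's 48.6035): `P_cell(β, θ(p)) ≤ Σᵢ wᵢ(t_pd, t_pp)·(6 log 2 + β·(−q₀ᵢ/2))`. [cite: Israel1979, Thm. I.3.4] [cite: ValentiStolzeHirschfeld1991, §II] -/
theorem emeryBoxBi2223OPMoreePP_pressureBilinearCap_m107o10 {β : ℝ} (hβ : 0 ≤ β) :
    HoldsOn (fun p : EmeryCoord → ℝ => emeryCellPressure β (emeryLine cuprateSigns (emeryLineCoords (((-107/10 : ℚ)) : ℝ) p)) ≤
      (((139/100 : ℝ) - p .tpd) * ((18/25 : ℝ) - p .tpp) * (6 * Real.log 2 + β * (876461719/20000000)) +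
        (p .tpd - (59/50 : ℝ)) * ((18/25 : ℝ) - p .tpp) * (6 * Real.log 2 + β * (937989063/20000000)) +
        ((139/100 : ℝ) - p .tpd) * (p .tpp - (61/100 : ℝ)) * (6 * Real.log 2 + β * (455255469/10000000)) +
        (p .tpd - (59/50 : ℝ)) * (p .tpp - (61/100 : ℝ)) * (6 * Real.log 2 + β * (97207/2000))) / (231/10000 : ℝ)) emeryBoxBi2223OPMoreePP := by
  have h := holdsOn_emeryCellPressureBilinearCap_of_tiltedCuO4Certificates (E := emeryBoxBi2223OPMoreePP) (eA := bi2223OPMoreePPEmery_tpd) (eB := bi2223OPMoreePPEmery_tpp) (eD := bi2223OPMoreePPEmery_Delta) (eUd := bi2223OPMoreePPEmery_Udd) (eUp := bi2223OPMoreePPEmery_Upp) (by simp [emeryBoxBi2223OPMoreePP, emeryBoxBi2223OPMoreePPSrc, Function.update]) (by simp [emeryBoxBi2223OPMoreePP, emeryBoxBi2223OPMoreePPSrc, Function.update]) (Function.update_self _ _ _) (by simp [emeryBoxBi2223OPMoreePP, emeryBoxBi2223OPMoreePPSrc, Function.update]) (by simp [emeryBoxBi2223OPMoreePP, emeryBoxBi2223OPMoreePPSrc,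 Function.update])
    (by rw [bi2223OPMoreePPEmery_tpd, Entry.encl_ofEnds_fst, Entry.encl_ofEnds_snd]; norm_num)
    (by rw [bi2223OPMoreePPEmery_tpp, Entry.encl_ofEnds_fst, Entry.encl_ofEnds_snd]; norm_num)
    cuprateSigns hβ (M := 2) two_pos (fun _ => 0) (fun _ ω' _ => re_expect_zero_cuO4 ω') bi2223OPMoreePPFloor_mu bi2223OPMoreePPFloor_q0 bi2223OPMoreePPFloor_hq_lowerCorner
    (εp := -107/10) bi2223OPMoreePPFloor_mu_le_m107o10
  intro p hp
  have h' := h p hp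
  simp only [bi2223OPMoreePPEmery_tpd, bi2223OPMoreePPEmery_tpp, Entry.encl_ofEnds_fst, Entry.encl_ofEnds_snd, bi2223OPMoreePPFloor_q0,
    Matrix.cons_val_zero, Matrix.cons_val_one, Matrix.cons_val_two, Matrix.cons_val, Matrix.head_cons, Matrix.tail_cons] at h'
  refine h'.trans (le_of_eq ?_)
  push_cast
  ring

end Summit.Ventures.CertifiedManyBodySolver.Downfold

end
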